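import Mathlib
import Literature.NumberTheory.LFunctions.Zhang2022.Section11AFEWindowTools
import HarnessLib

/-!
# Zhang (2022) §11, proof of Lemma 11.2 for `χψ` — the contour move (6.5) with explicit constants

Topic `Literature/NumberTheory/LFunctions/Zhang2022` (Landau–Siegel audit tree; verdict-neutral).
Y. Zhang, arXiv:2211.02515v1 (2022) [Zhang2022LandauSiegel] — **an unrefereed manuscript under
adjudication** (campaign D-0069; nothing here bears on Theorems 1–2 or on Landau–Siegel zeros).
Companion of `Section11AFEWindowTools`. PROVED: `norm_integrandDiff_neg_one_le` (the `I″`-integrand on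
`u = −1` is `≤ K₀(|v|+|t|+2)²e^{−bv²}`), `norm_integrandDiff_horiz_le` (on the horizontal edges
`u ± i𝓛²⁰` it is `≤ K₁e^{b}e^{−b𝓛⁴⁰}`, Stirling via the tree's `StripGrowth.norm_Zfac_le`), and
`windowMove11_core`: `|(1/2πi)∫_{(−1)}F − (1/2πi)∫_{−i𝓛²⁰}^{i𝓛²⁰}F| ≤ K₀e^{−bV²/2}M + 2K₁e^{b}e^{−bV²}`
with every constant explicit (`b = 1/(4𝓛³⁰)`, `V = 𝓛²⁰`).
[cite: Zhang2022LandauSiegel, §6 Lemma 6.1 (proof) (6.5) p. 32; §11 Lemma 11.2 p. 65]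
-/

noncomputable section

open Complex Real ComplexConjugate MeasureTheory Set Filter Topology

namespace Literature.NumberTheory.LFunctions.Zhang2022.Section11AFE

open Skeleton GaussWeight Section6Statements

/-! ## §1. Pointwise bounds for the `I″`-integrand and the contour move with explicit constants -/

section BlockF

variable {D : ℕ} [NeZero D] (χ : DirichletCharacter ℂ D) (x : Chr D)

/-- The `I″`-integrand on the line `u = −1`: `≤ ((Gk² + R)·⌈N⌉·X⁻¹e^{b})·(|v| + |t| + 2)²e^{−bv²}`,
`b = 1/(4𝓛³⁰)`, `k = Dp` (polynomial growth of `|Z(−1/2+iτ,χψ)|` — the hypothesis `hG` is the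
tree's `StripGrowth.exists_norm_Zfac_le` — and `|Z(s,χψ)R^{−w}| = R` there).
[cite: Zhang2022LandauSiegel, §6 (6.5) p. 32] -/
theorem norm_integrandDiff_neg_one_le {G : ℝ}
    (hG : ∀ (k : ℕ) [NeZero k] (θ : DirichletCharacter ℂ k) (z : ℂ), -((1 : ℕ) : ℝ) ≤ z.re → z.re ≤ 0 →
      ‖GammaFactor.Zfac θ z‖ ≤ G * (k : ℝ) ^ (1 + 1) * (|z.im| + (1 : ℕ) + 1) ^ (1 + 1))
    {s : ℂ} (hs : s.re = 1 / 2) (hZ1 : ‖Zpc χ x s‖ ≤ 1) {X : ℝ} (hX : 0 < X) (hR : 0 < bigR D)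
    (N : ℝ) (v : ℝ) :
    ‖integrandDiff χ x X N s (((-1 : ℝ) : ℂ) + (v : ℂ) * I)‖ ≤
      ((G * ((D * x.p : ℕ) : ℝ) ^ 2 + bigR D) * ⌈N⌉₊ * (X⁻¹ * Real.exp (1 / (4 * ell D ^ 30)))) *
        ((|v| + (|s.im| + 2)) ^ 2 * Real.exp (-(1 / (4 * ell D ^ 30)) * v ^ 2)) := by
  set b : ℝ := 1 / (4 * ell D ^ 30) with hb
  set k : ℕ := D * x.p with hk
  set w : ℂ := ((-1 : ℝ) : ℂ) + (v : ℂ) * I with hw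
  have hG0 : 0 ≤ G := by
    have h := hG k (psiChi χ x) (s + w) (by simp [hw, hs]) (by simp [hw, hs]; norm_num)
    have : (0 : ℝ) ≤ G * (k : ℝ) ^ (1 + 1) * (|(s + w).im| + (1 : ℕ) + 1) ^ (1 + 1) :=
      le_trans (norm_nonneg _) h
    have hpos : (0 : ℝ) < (k : ℝ) ^ (1 + 1) * (|(s + w).im| + (1 : ℕ) + 1) ^ (1 + 1) := by
      have : (0 : ℝ) < k := by
        have := NeZero.ne (D * x.p); rw [← hk] at this; exact_mod_cast Nat.pos_of_ne_zero this
      positivity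
    by_contra hneg
    push Not at hneg
    have : G * (k : ℝ) ^ (1 + 1) * (|(s + w).im| + (1 : ℕ) + 1) ^ (1 + 1) < 0 := by
      rw [mul_assoc]; exact mul_neg_of_neg_of_pos hneg hpos
    linarith
  -- the four factors
  have hz1 : -((1 : ℕ) : ℝ) ≤ (s + w).re := by simp [hw, hs]
  have hz2 : (s + w).re ≤ 0 := by simp [hw, hs]; norm_num
  have hZb := hG k (psiChi χ x) (s + w) hz1 hz2
  have him : |(s + w).im| + ((1 : ℕ) : ℝ) + 1 ≤ |v| + (|s.im| + 2) := by
    simp only [hw, Complex.add_im, Complex.ofReal_im, Complex.mul_im, Complex.ofReal_re, Complex.I_im,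
      Complex.I_re, mul_zero, mul_one, zero_add, add_zero, Nat.cast_one]
    have := abs_add_le s.im v
    linarith
  have him0 : 0 ≤ |(s + w).im| + ((1 : ℕ) : ℝ) + 1 := by positivity
  have hZb' : ‖Zpc χ x (s + w)‖ ≤ G * (k : ℝ) ^ 2 * (|v| + (|s.im| + 2)) ^ 2 := by
    refine hZb.trans ?_
    rw [show (1 + 1 : ℕ) = 2 from rfl]
    exact mul_le_mul_of_nonneg_left (pow_le_pow_left₀ him0 him 2) (by positivity)
  have hRw : ‖((bigR D : ℝ) : ℂ) ^ (-w)‖ = bigR D := by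
    rw [Complex.norm_cpow_eq_rpow_re_of_pos hR]; simp [hw]
  have hA1 : 1 ≤ (|v| + (|s.im| + 2)) ^ 2 := by
    have : 1 ≤ |v| + (|s.im| + 2) := by linarith [abs_nonneg v, abs_nonneg s.im]
    exact one_le_pow₀ this
  have hdiff : ‖Zpc χ x (s + w) - Zpc χ x s * ((bigR D : ℝ) : ℂ) ^ (-w)‖ ≤
      (G * (k : ℝ) ^ 2 + bigR D) * (|v| + (|s.im| + 2)) ^ 2 := by
    calc ‖Zpc χ x (s + w) - Zpc χ x s * ((bigR D : ℝ) : ℂ) ^ (-w)‖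
        ≤ ‖Zpc χ x (s + w)‖ + ‖Zpc χ x s‖ * ‖((bigR D : ℝ) : ℂ) ^ (-w)‖ := by
          rw [← norm_mul]; exact norm_sub_le _ _
      _ ≤ G * (k : ℝ) ^ 2 * (|v| + (|s.im| + 2)) ^ 2 + 1 * bigR D := by
          rw [hRw]; gcongr
      _ ≤ G * (k : ℝ) ^ 2 * (|v| + (|s.im| + 2)) ^ 2 + bigR D * (|v| + (|s.im| + 2)) ^ 2 := by
          rw [one_mul]; gcongr; exact le_mul_of_one_le_right hR.le hA1
      _ = (G * (k : ℝ) ^ 2 + bigR D) * (|v| + (|s.im| + 2)) ^ 2 := by ring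
  have hH := norm_headPc_neg_one_le χ x hs N v
  have hKb := norm_kern_neg_one_le (D := D) hX v
  rw [← hb] at hKb
  rw [hw] at hdiff
  calc ‖integrandDiff χ x X N s (((-1 : ℝ) : ℂ) + (v : ℂ) * I)‖
      = ‖Zpc χ x (s + (((-1 : ℝ) : ℂ) + (v : ℂ) * I)) -
            Zpc χ x s * ((bigR D : ℝ) : ℂ) ^ (-(((-1 : ℝ) : ℂ) + (v : ℂ) * I))‖ *
          ‖headPc χ x N s (((-1 : ℝ) : ℂ) + (v : ℂ) * I)‖ * ‖kern D X (((-1 : ℝ) : ℂ) + (v : ℂ) * I)‖ := by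
        rw [integrandDiff, norm_mul, norm_mul]
    _ ≤ ((G * (k : ℝ) ^ 2 + bigR D) * (|v| + (|s.im| + 2)) ^ 2) * ⌈N⌉₊ *
          (X⁻¹ * Real.exp b * Real.exp (-b * v ^ 2)) := by
        gcongr
    _ = ((G * (k : ℝ) ^ 2 + bigR D) * ⌈N⌉₊ * (X⁻¹ * Real.exp b)) *
          ((|v| + (|s.im| + 2)) ^ 2 * Real.exp (-b * v ^ 2)) := by ring

/-- The `I″`-integrand on the horizontal segments `w = u ± iV`, `−1 ≤ u ≤ 0`, `|V| ≥ 1`,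
`|t ± V| ≥ 152`: `≤ (4k²(|t| + |V|)² + R)·⌈N⌉·e^{b}·e^{−bV²}` (`X ≥ 1`, `R ≥ 1`; Stirling for
`|Z(s+w,χψ)|`, the tree's `StripGrowth.norm_Zfac_le`). [cite: Zhang2022LandauSiegel, §6 (6.5) p. 32] -/
theorem norm_integrandDiff_horiz_le (hD : 2 ≤ D) {s : ℂ} (hs : s.re = 1 / 2) (hZ1 : ‖Zpc χ x s‖ ≤ 1) {X : ℝ}
    (hX1 : 1 ≤ X) (hR1 : 1 ≤ bigR D) (N : ℝ) {u y : ℝ} (hu1 : -1 ≤ u) (hu0 : u ≤ 0) (hy : 1 ≤ |y|)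
    (hty : 152 ≤ |s.im + y|) :
    ‖integrandDiff χ x X N s ((u : ℂ) + (y : ℂ) * I)‖ ≤
      (4 * ((D * x.p : ℕ) : ℝ) ^ 2 * (|s.im| + |y|) ^ 2 + bigR D) * ⌈N⌉₊ *
        Real.exp (1 / (4 * ell D ^ 30)) * Real.exp (-(1 / (4 * ell D ^ 30)) * y ^ 2) := by
  set b : ℝ := 1 / (4 * ell D ^ 30) with hb
  set k : ℕ := D * x.p with hk
  set w : ℂ := (u : ℂ) + (y : ℂ) * I with hw
  have hX : 0 < X := by linarith
  have hR : 0 < bigR D := by linarith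
  have hwre : w.re = u := by simp [hw]
  have hwim : w.im = y := by simp [hw]
  have hw0 : w ≠ 0 := by
    intro h; have := congrArg Complex.im h; rw [hwim] at this; simp at this
    rw [this, abs_zero] at hy; linarith
  have hwn : 1 ≤ ‖w‖ := le_trans hy (by rw [← hwim]; exact Complex.abs_im_le_norm w)
  -- `Z(s+w,χψ)` by Stirling
  have hσ : |(s + w).re| ≤ ((1 : ℕ) : ℝ) := by
    simp only [Complex.add_re, hs, hwre, Nat.cast_one]; rw [abs_le]; constructor <;> linarith
  have ht : 38 * (((1 : ℕ) : ℝ) + 1) ^ 2 ≤ |(s + w).im| := by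
    simp only [Complex.add_im, hwim, Nat.cast_one]; norm_num; linarith
  have hZ := StripGrowth.norm_Zfac_le (psiChi χ x) (A := 1) le_rfl hσ ht
  have hZ' : ‖Zpc χ x (s + w)‖ ≤ 4 * (k : ℝ) ^ 2 * (|s.im| + |y|) ^ 2 := by
    rw [Zpc]
    refine hZ.trans ?_
    rw [show (1 + 1 : ℕ) = 2 from rfl]
    have him : |(s + w).im| ≤ |s.im| + |y| := by
      simp only [Complex.add_im, hwim]; exact abs_add_le _ _
    exact mul_le_mul_of_nonneg_left (pow_le_pow_left₀ (abs_nonneg _) him 2) (by positivity)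
  -- `R^{−w}`
  have hRw : ‖((bigR D : ℝ) : ℂ) ^ (-w)‖ ≤ bigR D := by
    rw [Complex.norm_cpow_eq_rpow_re_of_pos hR]
    simp only [Complex.neg_re, hwre]
    calc bigR D ^ (-u) ≤ bigR D ^ (1 : ℝ) := Real.rpow_le_rpow_of_exponent_le hR1 (by linarith)
      _ = bigR D := Real.rpow_one _
  have hdiff : ‖Zpc χ x (s + w) - Zpc χ x s * ((bigR D : ℝ) : ℂ) ^ (-w)‖ ≤
      4 * (k : ℝ) ^ 2 * (|s.im| + |y|) ^ 2 + bigR D := by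
    calc ‖Zpc χ x (s + w) - Zpc χ x s * ((bigR D : ℝ) : ℂ) ^ (-w)‖
        ≤ ‖Zpc χ x (s + w)‖ + ‖Zpc χ x s‖ * ‖((bigR D : ℝ) : ℂ) ^ (-w)‖ := by
          rw [← norm_mul]; exact norm_sub_le _ _
      _ ≤ 4 * (k : ℝ) ^ 2 * (|s.im| + |y|) ^ 2 + 1 * bigR D := by gcongr
      _ = _ := by rw [one_mul]
  -- the head
  have hH : ‖headPc χ x N s w‖ ≤ ⌈N⌉₊ := by
    unfold headPc
    refine (norm_sum_le _ _).trans ?_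
    calc ∑ n ∈ Finset.Ico 1 ⌈N⌉₊, ‖conj (pc χ x n) * (n : ℂ) ^ (-(1 - s - w))‖
        ≤ ∑ n ∈ Finset.Ico 1 ⌈N⌉₊, (1 : ℝ) := by
          refine Finset.sum_le_sum fun n hn => ?_
          have hn1 : 1 ≤ n := (Finset.mem_Ico.mp hn).1
          rw [norm_mul, Complex.norm_conj, Complex.norm_natCast_cpow_of_pos (by omega)]
          have hre : (-(1 - s - w)).re ≤ 0 := by simp [hs, hwre]; linarith
          have h1 : ‖pc χ x n‖ ≤ 1 := by
            rw [pc, norm_mul]; exact mul_le_one₀ (x.ψ.norm_le_one _) (norm_nonneg _) (χ.norm_le_one _)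
          have h2 : (n : ℝ) ^ (-(1 - s - w)).re ≤ 1 :=
            Real.rpow_le_one_of_one_le_of_nonpos (by exact_mod_cast hn1) hre
          have h0 : 0 ≤ (n : ℝ) ^ (-(1 - s - w)).re := Real.rpow_nonneg (Nat.cast_nonneg n) _
          nlinarith
      _ = ((⌈N⌉₊ - 1 : ℕ) : ℝ) := by simp
      _ ≤ ⌈N⌉₊ := by exact_mod_cast Nat.sub_le _ _
  -- the kernel
  have hXw : ‖((X : ℝ) : ℂ) ^ w‖ ≤ 1 := by
    rw [Complex.norm_cpow_eq_rpow_re_of_pos hX, hwre]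
    exact Real.rpow_le_one_of_one_le_of_nonpos hX1 hu0
  have hω : ‖omega1 (ell D ^ 30) w‖ ≤ Real.exp b * Real.exp (-b * y ^ 2) := by
    have := norm_omega1 (ell D ^ 30) u y
    rw [show ((u : ℝ) : ℂ) + (y : ℝ) * I = w from rfl] at this
    rw [this, ← Real.exp_add]
    refine Real.exp_le_exp.mpr ?_
    rw [hb]
    have hu2 : u ^ 2 ≤ 1 := by nlinarith
    have h4 : 0 < 4 * ell D ^ 30 := by
      have : (1 : ℝ) < D := by exact_mod_cast lt_of_lt_of_le (by norm_num) hD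
      have := Real.log_pos this
      positivity
    have e : (u ^ 2 - y ^ 2) / (4 * ell D ^ 30) =
        u ^ 2 * (1 / (4 * ell D ^ 30)) + -(1 / (4 * ell D ^ 30)) * y ^ 2 := by
      field_simp; ring
    rw [e]
    have : 0 < 1 / (4 * ell D ^ 30) := by positivity
    nlinarith
  have hwinv : ‖w‖⁻¹ ≤ 1 := inv_le_one_of_one_le₀ hwn
  rw [hw] at hdiff hH hXw hω hwinv
  calc ‖integrandDiff χ x X N s ((u : ℂ) + (y : ℂ) * I)‖
      = ‖Zpc χ x (s + ((u : ℂ) + (y : ℂ) * I)) - Zpc χ x s * ((bigR D : ℝ) : ℂ) ^ (-((u : ℂ) + (y : ℂ) * I))‖ *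
          ‖headPc χ x N s ((u : ℂ) + (y : ℂ) * I)‖ *
          (‖((X : ℝ) : ℂ) ^ ((u : ℂ) + (y : ℂ) * I)‖ * ‖omega1 (ell D ^ 30) ((u : ℂ) + (y : ℂ) * I)‖ *
            ‖((u : ℂ) + (y : ℂ) * I)‖⁻¹) := by
        rw [integrandDiff, kern, norm_mul, norm_mul, norm_div, norm_mul, div_eq_mul_inv]
    _ ≤ (4 * (k : ℝ) ^ 2 * (|s.im| + |y|) ^ 2 + bigR D) * ⌈N⌉₊ *
          (1 * (Real.exp b * Real.exp (-b * y ^ 2)) * 1) := by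
        gcongr
    _ = _ := by ring

/-- **(f), the contour move with explicit constants**: for `D ≥ 3`, `𝓛 ≥ 2`, `ψ ∈ Ψ`, `σ = 1/2`,
`|t − 2πt₀| < 𝓛₁`, `z ≥ 1/2`, with `X = P^z`, `N = P₁`, `V = 𝓛²⁰`, `b = 1/(4𝓛³⁰)`, `k = Dp`:
`|(1/2πi)∫_{(−1)} F − (1/2πi)∫_{0−iV}^{0+iV} F| ≤ K₀e^{−bV²/2}M + 2K₁e^{b}e^{−bV²}` where
`K₀ = (Gk²+R)⌈N⌉X⁻¹e^{b}`, `M = (4/b)√(4π/b) + 2(|t|+2)²√(2π/b)`, `K₁ = (4k²(|t|+V)²+R)⌈N⌉` — the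
rectangle `[−1,0]×[−V,V]` (`rect_diffReg`) plus the Gaussian tails (`gauss_tail_quad_le`) and the
horizontal segments (`norm_integrandDiff_horiz_le`). [cite: Zhang2022LandauSiegel, §6 (6.5) p. 32] -/
theorem windowMove11_core {G : ℝ} (hG0 : 0 ≤ G)
    (hG : ∀ (k : ℕ) [NeZero k] (θ : DirichletCharacter ℂ k) (z : ℂ), -((1 : ℕ) : ℝ) ≤ z.re → z.re ≤ 0 →
      ‖GammaFactor.Zfac θ z‖ ≤ G * (k : ℝ) ^ (1 + 1) * (|z.im| + (1 : ℕ) + 1) ^ (1 + 1))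
    (hD : 3 ≤ D) (hp : χ.IsPrimitive) (hL : 2 ≤ ell D) {s : ℂ} (hs : InRange112 D s) {z : ℝ}
    (hz1 : 0.5 ≤ z) :
    ‖vline (integrandDiff χ x (bigP D ^ z) (Skeleton.P1 D) s) (-1) -
        vseg (integrandDiff χ x (bigP D ^ z) (Skeleton.P1 D) s) 0 (ell D ^ 20)‖ ≤
      ((G * ((D * x.p : ℕ) : ℝ) ^ 2 + bigR D) * ⌈Skeleton.P1 D⌉₊ *
          ((bigP D ^ z)⁻¹ * Real.exp (1 / (4 * ell D ^ 30)))) *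
        (Real.exp (-(1 / (4 * ell D ^ 30) / 2) * (ell D ^ 20) ^ 2) *
          (4 / (1 / (4 * ell D ^ 30)) * Real.sqrt (π / (1 / (4 * ell D ^ 30) / 4)) +
            2 * (|s.im| + 2) ^ 2 * Real.sqrt (π / (1 / (4 * ell D ^ 30) / 2)))) +
      2 * ((4 * ((D * x.p : ℕ) : ℝ) ^ 2 * (|s.im| + |ell D ^ 20|) ^ 2 + bigR D) * ⌈Skeleton.P1 D⌉₊ *
        Real.exp (1 / (4 * ell D ^ 30)) * Real.exp (-(1 / (4 * ell D ^ 30)) * (ell D ^ 20) ^ 2)) := by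
  obtain ⟨hre, him⟩ := hs
  have hD2 : 2 ≤ D := le_trans (by norm_num) hD
  have hℓ1 : 1 ≤ ell D := by linarith
  have hℓ0 : 0 < ell D := by linarith
  set L : ℝ := ell D with hLdef
  set V : ℝ := L ^ 20 with hVdef
  set b : ℝ := 1 / (4 * L ^ 30) with hbdef
  set X : ℝ := bigP D ^ z with hXdef
  set N : ℝ := Skeleton.P1 D with hNdef
  set t : ℝ := s.im with htdef
  have hb0 : 0 < b := by rw [hbdef]; positivity
  have hP : 0 < bigP D := Real.exp_pos _
  have hP1 : 1 ≤ bigP D := by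
    rw [bigP]; exact Real.one_le_exp (by positivity)
  have hX : 0 < X := Real.rpow_pos_of_pos hP z
  have hX1 : 1 ≤ X := Real.one_le_rpow hP1 (by linarith)
  have hV1 : 1 ≤ V := one_le_pow₀ hℓ1
  have hV0 : 0 < V := by linarith
  have ht0def : t0 D = L ^ 519 := rfl
  have hR1 : 1 ≤ bigR D := by
    rw [bigR, ht0def]
    have hD1 : (1 : ℝ) ≤ D := by exact_mod_cast le_trans (by norm_num) hD
    have h519 : (1 : ℝ) ≤ L ^ 519 := one_le_pow₀ hℓ1
    calc (1 : ℝ) = 1 * 1 * 1 := by ring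
      _ ≤ (D : ℝ) * bigP D * L ^ 519 := by gcongr
  have hR : 0 < bigR D := by linarith
  -- the height `t`: `t − V ≥ 152`
  have h405 : L ^ 405 ≤ L ^ 519 := pow_le_pow_right₀ hℓ1 (by norm_num)
  have h20 : L ^ 20 ≤ L ^ 519 := pow_le_pow_right₀ hℓ1 (by norm_num)
  have h519 : (152 : ℝ) ≤ L ^ 519 := by
    calc (152 : ℝ) ≤ 2 ^ 8 := by norm_num
      _ ≤ L ^ 8 := pow_le_pow_left₀ (by norm_num) hL 8
      _ ≤ L ^ 519 := pow_le_pow_right₀ hℓ1 (by norm_num)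
  have htlow : 4 * L ^ 519 ≤ t - V := by
    have h1 := (abs_lt.mp him).1
    rw [ell1, ht0def] at h1
    rw [hVdef, htdef]
    nlinarith [Real.pi_gt_three]
  have htV : V < t := by linarith
  have htpos : 0 < t := by linarith
  have htmV : 152 ≤ |t + -V| := by
    rw [abs_of_pos (by linarith)]; linarith
  have htpV : 152 ≤ |t + V| := by
    rw [abs_of_pos (by linarith)]; linarith
  have hZ : ‖Zpc χ x s‖ = 1 := norm_Zpc_eq_one χ (psiChiPrimitive_holds D χ x hD hp) hre htpos
  -- the integrand on the line and its integrability
  set Fd : ℂ → ℂ := integrandDiff χ x X N s with hFd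
  have hiD : Integrable fun v : ℝ => Fd (((-1 : ℝ) : ℂ) + (v : ℂ) * I) := by
    have e2 : (fun v : ℝ => Fd (((-1 : ℝ) : ℂ) + (v : ℂ) * I)) = fun v : ℝ =>
        integrandHead χ x X N s (((-1 : ℝ) : ℂ) + (v : ℂ) * I) -
          integrandMain χ x X N s (((-1 : ℝ) : ℂ) + (v : ℂ) * I) := by
      funext v; simp only [hFd, integrandHead, integrandMain, integrandDiff]; ring
    rw [e2]
    exact (integrable_integrandHead χ x hD2 hre hX N).sub (integrable_integrandMain χ x hD2 hre hX hR N)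
  -- split the line at `|v| = V`
  set S : Set ℝ := Set.Ioc (-V) V with hSdef
  have hSm : MeasurableSet S := measurableSet_Ioc
  have hsplit := integral_add_compl hSm hiD
  have hIoc : ∫ v in S, Fd (((-1 : ℝ) : ℂ) + (v : ℂ) * I) =
      ∫ v in (-V)..V, Fd (((-1 : ℝ) : ℂ) + (v : ℂ) * I) := by
    rw [intervalIntegral.integral_of_le (by linarith)]
  -- the rectangle
  have hrect := rect_diffReg χ x hV0 htV hX hR N
  have eLeft : ∫ y in (-V)..V, diffReg χ x X N s ((-1 : ℝ) + y * I) =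
      ∫ y in (-V)..V, Fd (((-1 : ℝ) : ℂ) + (y : ℂ) * I) := by
    refine intervalIntegral.integral_congr fun y _ => ?_
    exact diffReg_eq_integrandDiff χ x X N s (by
      intro h; have := congrArg Complex.re h; simp at this)
  have eMid : ∫ y in (-V)..V, diffReg χ x X N s ((0 : ℝ) + y * I) =
      ∫ y in (-V)..V, Fd (((0 : ℝ) : ℂ) + (y : ℂ) * I) := by
    refine intervalIntegral.integral_congr_ae ?_
    have h0 : ∀ᵐ y : ℝ ∂volume, y ≠ 0 := by
      have : ({0}ᶜ : Set ℝ) ∈ ae volume := compl_mem_ae_iff.mpr (measure_singleton _)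
      filter_upwards [this] with v hv using hv
    filter_upwards [h0] with y hy _
    exact diffReg_eq_integrandDiff χ x X N s (by
      intro h; have := congrArg Complex.im h; simp at this; exact hy this)
  -- the horizontal segments
  have hhor : ∀ y : ℝ, |y| = V → 152 ≤ |t + y| →
      ‖∫ u in (-1 : ℝ)..0, diffReg χ x X N s (u + (y : ℝ) * I)‖ ≤
        (4 * ((D * x.p : ℕ) : ℝ) ^ 2 * (|t| + V) ^ 2 + bigR D) * ⌈N⌉₊ * Real.exp b *
          Real.exp (-b * V ^ 2) := by
    intro y hyV hty
    have hy1 : 1 ≤ |y| := by rw [hyV]; exact hV1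
    have hy0 : y ≠ 0 := by intro h; rw [h, abs_zero] at hy1; linarith
    have hbd : ∀ u ∈ Set.uIoc (-1 : ℝ) 0, ‖diffReg χ x X N s (u + (y : ℝ) * I)‖ ≤
        (4 * ((D * x.p : ℕ) : ℝ) ^ 2 * (|t| + V) ^ 2 + bigR D) * ⌈N⌉₊ * Real.exp b *
          Real.exp (-b * V ^ 2) := by
      intro u hu
      rw [Set.uIoc_of_le (by norm_num), Set.mem_Ioc] at hu
      rw [diffReg_eq_integrandDiff χ x X N s (by
        intro h; have := congrArg Complex.im h; simp at this; exact hy0 this)]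
      have h := norm_integrandDiff_horiz_le χ x hD2 hre hZ.le hX1 hR1 N hu.1.le hu.2 hy1 hty
      rw [hyV, show y ^ 2 = V ^ 2 by rw [← sq_abs y, hyV]] at h
      exact h
    have := intervalIntegral.norm_integral_le_of_norm_le_const hbd
    simpa using this
  have hBot := hhor (-V) (by rw [abs_neg, abs_of_pos hV0]) htmV
  have hTop := hhor V (abs_of_pos hV0) htpV
  -- the tails `|v| > V`
  set A : ℝ := |t| + 2 with hAdef
  set K₀ : ℝ := (G * ((D * x.p : ℕ) : ℝ) ^ 2 + bigR D) * ⌈N⌉₊ * (X⁻¹ * Real.exp b) with hK₀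
  set q : ℝ → ℝ := fun v => (|v| + A) ^ 2 * Real.exp (-b * v ^ 2) with hq
  have hpt : ∀ v : ℝ, ‖Fd (((-1 : ℝ) : ℂ) + (v : ℂ) * I)‖ ≤ K₀ * q v := by
    intro v
    have h := norm_integrandDiff_neg_one_le χ x hG hre hZ.le hX hR N v
    rw [hK₀, hq]; exact h
  have hK₀0 : 0 ≤ K₀ := by rw [hK₀]; positivity
  have hqi : Integrable q := integrable_absAddSq_mul_gauss hb0 A
  have hTail : ‖∫ v in Sᶜ, Fd (((-1 : ℝ) : ℂ) + (v : ℂ) * I)‖ ≤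
      K₀ * (Real.exp (-(b / 2) * V ^ 2) *
        (4 / b * Real.sqrt (π / (b / 4)) + 2 * A ^ 2 * Real.sqrt (π / (b / 2)))) := by
    calc ‖∫ v in Sᶜ, Fd (((-1 : ℝ) : ℂ) + (v : ℂ) * I)‖
        ≤ ∫ v in Sᶜ, ‖Fd (((-1 : ℝ) : ℂ) + (v : ℂ) * I)‖ := norm_integral_le_integral_norm _
      _ ≤ ∫ v in Sᶜ, K₀ * q v :=
          setIntegral_mono_on hiD.norm.integrableOn (hqi.const_mul K₀).integrableOn hSm.compl
            (fun v _ => hpt v)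
      _ = K₀ * ∫ v in Sᶜ, q v := integral_const_mul _ _
      _ ≤ K₀ * (Real.exp (-(b / 2) * V ^ 2) *
            (4 / b * Real.sqrt (π / (b / 4)) + 2 * A ^ 2 * Real.sqrt (π / (b / 2)))) :=
          mul_le_mul_of_nonneg_left (gauss_tail_quad_le hb0 A hV0.le) hK₀0
  -- assemble
  have hvl : vline Fd (-1) - vseg Fd 0 V = (1 / (2 * π) : ℂ) *
      ((∫ v in Sᶜ, Fd (((-1 : ℝ) : ℂ) + (v : ℂ) * I)) +
        -I * ((∫ u in (-1 : ℝ)..0, diffReg χ x X N s (u + (-V : ℝ) * I)) -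
          ∫ u in (-1 : ℝ)..0, diffReg χ x X N s (u + (V : ℝ) * I))) := by
    rw [vline, vseg, ← hsplit, hIoc, ← hrect, eLeft, eMid]
    push_cast
    ring
  have h2π : ‖(1 / (2 * π) : ℂ)‖ ≤ 1 := by
    have : (1 / (2 * π) : ℂ) = ((1 / (2 * π) : ℝ) : ℂ) := by push_cast; ring
    rw [this, Complex.norm_real, Real.norm_eq_abs, abs_of_pos (by positivity)]
    rw [div_le_one (by positivity)]; linarith [Real.pi_gt_three]
  rw [hvl, norm_mul]
  have habs : |L ^ 20| = V := abs_of_pos hV0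
  rw [habs]
  calc ‖(1 / (2 * π) : ℂ)‖ * ‖(∫ v in Sᶜ, Fd (((-1 : ℝ) : ℂ) + (v : ℂ) * I)) +
          -I * ((∫ u in (-1 : ℝ)..0, diffReg χ x X N s (u + (-V : ℝ) * I)) -
            ∫ u in (-1 : ℝ)..0, diffReg χ x X N s (u + (V : ℝ) * I))‖
      ≤ 1 * (‖∫ v in Sᶜ, Fd (((-1 : ℝ) : ℂ) + (v : ℂ) * I)‖ +
          (‖∫ u in (-1 : ℝ)..0, diffReg χ x X N s (u + (-V : ℝ) * I)‖ +
            ‖∫ u in (-1 : ℝ)..0, diffReg χ x X N s (u + (V : ℝ) * I)‖)) := by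
        gcongr
        refine (norm_add_le _ _).trans ?_
        gcongr
        rw [norm_mul, norm_neg, Complex.norm_I, one_mul]
        exact norm_sub_le _ _
    _ ≤ K₀ * (Real.exp (-(b / 2) * V ^ 2) *
            (4 / b * Real.sqrt (π / (b / 4)) + 2 * A ^ 2 * Real.sqrt (π / (b / 2)))) +
          2 * ((4 * ((D * x.p : ℕ) : ℝ) ^ 2 * (|t| + V) ^ 2 + bigR D) * ⌈N⌉₊ * Real.exp b *
            Real.exp (-b * V ^ 2)) := by
        rw [one_mul]; linarith [hTail, hBot, hTop]


end BlockF

end Literature.NumberTheory.LFunctions.Zhang2022.Section11AFE
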